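import Summits.NavierStokesRegularity.NavierStokesRegularity.Theorems.SqueezeCycleExtremalBiaxialitySubcriticalReductions
import Literature.Analysis.FluidPDE.LerayGaugeStrainSpectrum

/-!
# Crux `ExtremalBiaxialitySubcritical` (stmt-NavierStokesRegularity-11609), negative side:
# which hypotheses are load-bearing

Route `SqueezeCycle`, crux
`Summit.NavierStokesRegularity.NavierStokesRegularity.Theses.SqueezeCycle.ExtremalBiaxialitySubcritical`
(`∀ C m u t₀ x₀, t₀ < 0 → u ∈ 𝒦_C → [Λ_u(t₀,x₀) ≥ m] → [∀ v' ∈ 𝒦_C, Λ_{v'} ≤ m everywhere] →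
m < 1/8`, both brackets in Courant–Fischer two-frame form). Extracted from the crux work file
`Cruxes/ExtremalBiaxialitySubcritical/Disproof.lean` (cdisprove adversary, generation 2, D-0016);
companion of `Negative/ExactStrainFlows` (membership, self-maximality) and `Negative/Saddle`.
Every statement below is the crux with ONE hypothesis dropped, all other clauses verbatim.

* `squeezeClass_congr` — `𝒦_C` only constrains negative times: fields agreeing on every slice
  `t < 0` are members together (transfer lemma; used by the `t₀ < 0` witness).
* `false_without_attainment` — drop the attainment clause: false (`C = 0`, `u ≡ 0 ∈ 𝒦_0`,
  `m = 1` is class-maximal over `𝒦_0 = {0}` but `1 ≥ 1/8`).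
* `false_without_time` — drop the guard `t₀ < 0`: false (the member of `𝒦_0` equal to `0` for
  `t < 0` and to `−x` for `t ≥ 0` "attains" `m = 1` at the junk time `t₀ = 1`, gauge weight
  `−t₀ = −1`).
* `withoutMaximality_of_squeezeLiouville`, `squeezeLiouville_of_mustSqueeze_of_withoutMaximality`
  — drop class-maximality: the resulting statement ("`Λ < 1/8` at every point of every element of
  every `𝒦_C`") is sandwiched between the route target `SqueezeLiouville` and
  `MustSqueeze → SqueezeLiouville`; maximality is exactly as hard as the Liouville problem.

Together with the cycle-1 calibration now in the tree (`nonneg_of_maximal`: `m ≥ 0`;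
`extremalBiaxialitySubcritical_of_squeezeLiouville`, `_of_small`, `_bootstrap`; `𝒦_C = ∅` for
`C < 0`): all four hypotheses and the guard are load-bearing, the content sits at `C > ε`,
`m ≥ 1/4`, and a refutation of the crux is a NONTRIVIAL element of some `𝒦_C` attaining a
class-maximal `Λ ≥ 1/4` — a Type-I ancient counterexample to the KNSS Liouville problem.
-/

noncomputable section

open Set Function Filter MeasureTheory
open scoped RealInnerProductSpace

namespace Summit.NavierStokesRegularity.NavierStokesRegularity.Theorems.ExtremalBiaxialitySubcritical.Negative

open Literature.Analysis.FluidPDE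
open Summit.NavierStokesRegularity.NavierStokesRegularity.Theses

/-! ### `𝒦_C` only sees negative times -/

/-- **Transfer**: two fields that agree on every slice `t < 0` are elements of the crux's inline
class `𝒦_C` together (every clause — joint smoothness on `Iio 0 × ℝ³`, divergence, the KNSS-mild
Oseen identity for `s < t < 0`, the Type-I rate on `t < 0`, the scaled energies over cylinders
below `t₀ ≤ 0` — evaluates the field at negative times only). [folklore] -/
theorem squeezeClass_congr {C : ℝ} {u v : ℝ → (EuclideanSpace ℝ (Fin 3)) → (EuclideanSpace ℝ (Fin 3))} (huv : ∀ t < 0, u t = v t)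
    (hu : (ContDiffOn ℝ (⊤ : ℕ∞) (Function.uncurry u) (Set.Iio 0 ×ˢ Set.univ) ∧ (∀ t < 0, Literature.Analysis.FluidPDE.VectorCalculus.IsDivFree (u t)) ∧ (∀ s t : ℝ, s < t → t < 0 → ∀ x, u t x = Literature.Analysis.FluidPDE.heatFlow (u s) (t-s) x - ∫ τ in Set.Ioo s t, ∫ y, ((-(inner ℝ (x-y) (u τ y) / (2*(t-τ)) * Literature.Analysis.UnboundedOperators.heatKernel (t-τ) (x-y))) • u τ y + (∫ σ in Set.Ioi (t-τ), Literature.Analysis.UnboundedOperators.heatKernel σ (x-y) / (4*σ^2)) • (inner ℝ (x-y) (u τ y) • u τ y + inner ℝ (u τ y) (u τ y) • (x-y) + inner ℝ (x-y) (u τ y) • u τ y) - ((∫ σ in Set.Ioi (t-τ), Literature.Analysis.UnboundedOperators.heatKernel σ (x-y) / (8*σ^3)) * (inner ℝ (x-y) (u τ y) * inner ℝ (x-y) (u τ y))) • (x-y))) ∧ Literature.Analysis.FluidPDE.HasTypeITimeDecay C u ∧ (∀ (x₀ : EuclideanSpace ℝ (Fin 3)) (t₀ r : ℝ), t₀ ≤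 0 → 0 < r → (∀ t, t₀ - r^2 < t → t < t₀ → r⁻¹ * ∫ x in Metric.ball x₀ r, ‖u t x‖^2 ≤ C) ∧ r⁻¹ * ∫ t in Set.Ioo (t₀ - r^2) t₀, ∫ x in Metric.ball x₀ r, ‖fderiv ℝ (u t) x‖^2 ≤ C))) :
    (ContDiffOn ℝ (⊤ : ℕ∞) (Function.uncurry v) (Set.Iio 0 ×ˢ Set.univ) ∧ (∀ t < 0, Literature.Analysis.FluidPDE.VectorCalculus.IsDivFree (v t)) ∧ (∀ s t : ℝ, s < t → t < 0 → ∀ x, v t x = Literature.Analysis.FluidPDE.heatFlow (v s) (t-s) x - ∫ τ in Set.Ioo s t, ∫ y, ((-(inner ℝ (x-y) (v τ y) / (2*(t-τ)) * Literature.Analysis.UnboundedOperators.heatKernel (t-τ) (x-y))) • v τ y + (∫ σ in Set.Ioi (t-τ), Literature.Analysis.UnboundedOperators.heatKernel σ (x-y) / (4*σ^2)) • (inner ℝ (x-y) (v τ y) • v τ y + inner ℝ (v τ y) (v τ y) • (x-y) + inner ℝ (x-y) (v τ y) • v τ y) - ((∫ σ in Set.Ioi (t-τ), Literature.Analysis.UnboundedOperators.heatKernel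 σ (x-y) / (8*σ^3)) * (inner ℝ (x-y) (v τ y) * inner ℝ (x-y) (v τ y))) • (x-y))) ∧ Literature.Analysis.FluidPDE.HasTypeITimeDecay C v ∧ (∀ (x₀ : EuclideanSpace ℝ (Fin 3)) (t₀ r : ℝ), t₀ ≤ 0 → 0 < r → (∀ t, t₀ - r^2 < t → t < t₀ → r⁻¹ * ∫ x in Metric.ball x₀ r, ‖v t x‖^2 ≤ C) ∧ r⁻¹ * ∫ t in Set.Ioo (t₀ - r^2) t₀, ∫ x in Metric.ball x₀ r, ‖fderiv ℝ (v t) x‖^2 ≤ C)) := by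
  obtain ⟨h1, h2, h3, h4, h5⟩ := hu
  refine ⟨?_, fun t ht => ?_, fun s t hst ht x => ?_, fun t ht x => ?_, fun x₀ t₀ r ht₀ hr => ?_⟩
  · refine h1.congr fun q hq => ?_
    have hq1 : q.1 < 0 := (Set.mem_prod.1 hq).1
    show v q.1 q.2 = u q.1 q.2
    rw [huv q.1 hq1]
  · rw [← huv t ht]; exact h2 t ht
  · have hs : s < 0 := hst.trans ht
    rw [← huv t ht, ← huv s hs, h3 s t hst ht x]
    congr 1
    refine setIntegral_congr_fun measurableSet_Ioo fun τ hτ => ?_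
    simp only [huv τ (hτ.2.trans ht)]
  · rw [← huv t ht]; exact h4 t ht x
  · obtain ⟨hA, hE⟩ := h5 x₀ t₀ r ht₀ hr
    refine ⟨fun t h1t h2t => ?_, ?_⟩
    · rw [← huv t (h2t.trans_le ht₀)]; exact hA t h1t h2t
    · have e : ∫ t in Set.Ioo (t₀ - r ^ 2) t₀, ∫ x in Metric.ball x₀ r, ‖fderiv ℝ (v t) x‖ ^ 2 =
          ∫ t in Set.Ioo (t₀ - r ^ 2) t₀, ∫ x in Metric.ball x₀ r, ‖fderiv ℝ (u t) x‖ ^ 2 :=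
        setIntegral_congr_fun measurableSet_Ioo fun t ht => by
          simp only [huv t (ht.2.trans_le ht₀)]
      rw [e]; exact hE

/-! ### Calibration at `C = 0`: `𝒦_0 = {0}`, every `m ≥ 0` is class-maximal -/

/-- Every element of `𝒦_0` vanishes on `t < 0` (Type-I rate with constant `0`). [folklore] -/
theorem squeezeClass_zero_slice_zero {u : ℝ → (EuclideanSpace ℝ (Fin 3)) → (EuclideanSpace ℝ (Fin 3))}
    (hu : ContDiffOn ℝ (⊤ : ℕ∞) (Function.uncurry u) (Set.Iio 0 ×ˢ Set.univ) ∧ (∀ t < 0, Literature.Analysis.FluidPDE.VectorCalculus.IsDivFree (u t)) ∧ (∀ s t : ℝ, s < t → t < 0 → ∀ x, u t x = Literature.Analysis.FluidPDE.heatFlow (u s) (t-s) x - ∫ τ in Set.Ioo s t, ∫ y, ((-(inner ℝ (x-y) (u τ y) / (2*(t-τ)) * Literature.Analysis.UnboundedOperators.heatKernel (t-τ) (x-y))) • u τ y + (∫ σ in Set.Ioi (t-τ), Literature.Analysis.UnboundedOperators.heatKernel σ (x-y) / (4*σ^2)) • (inner ℝ (x-y) (u τ y) • u τ y + inner ℝ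 (u τ y) (u τ y) • (x-y) + inner ℝ (x-y) (u τ y) • u τ y) - ((∫ σ in Set.Ioi (t-τ), Literature.Analysis.UnboundedOperators.heatKernel σ (x-y) / (8*σ^3)) * (inner ℝ (x-y) (u τ y) * inner ℝ (x-y) (u τ y))) • (x-y))) ∧ Literature.Analysis.FluidPDE.HasTypeITimeDecay 0 u ∧ (∀ (x₀ : EuclideanSpace ℝ (Fin 3)) (t₀ r : ℝ), t₀ ≤ 0 → 0 < r → (∀ t, t₀ - r^2 < t → t < t₀ → r⁻¹ * ∫ x in Metric.ball x₀ r, ‖u t x‖^2 ≤ 0) ∧ r⁻¹ * ∫ t in Set.Ioo (t₀ - r^2) t₀, ∫ x in Metric.ball x₀ r, ‖fderiv ℝ (u t) x‖^2 ≤ 0))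
    {t : ℝ} (ht : t < 0) (x : (EuclideanSpace ℝ (Fin 3))) : u t x = 0 := by
  have := hu.2.2.2.1 t ht x
  rw [zero_div] at this
  exact norm_le_zero_iff.1 this

/-- **Over `𝒦_0` every `m ≥ 0` satisfies the crux's maximality clause** (all slices vanish, so
every quadratic form is `0 ≤ m(α² + β²)`; frame `(e₀, e₁)`). [folklore] -/
theorem isClassMax_zero {m : ℝ} (hm : 0 ≤ m) :
    (∀ v' : ℝ → EuclideanSpace ℝ (Fin 3) → EuclideanSpace ℝ (Fin 3), ContDiffOn ℝ (⊤ : ℕ∞) (Function.uncurry v') (Set.Iio 0 ×ˢ Set.univ) ∧ (∀ t < 0, Literature.Analysis.FluidPDE.VectorCalculus.IsDivFree (v' t)) ∧ (∀ s t : ℝ, s < t → t < 0 → ∀ x, v' t x = Literature.Analysis.FluidPDE.heatFlow (v' s) (t-s) x - ∫ τ in Set.Ioo s t, ∫ y, ((-(inner ℝ (x-y) (v' τ y) / (2*(t-τ)) * Literature.Analysis.UnboundedOperators.heatKernel (t-τ) (x-y))) • v' τ y + (∫ σ in Set.Ioi (t-τ), Literature.Analysis.UnboundedOperators.heatKernel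 σ (x-y) / (4*σ^2)) • (inner ℝ (x-y) (v' τ y) • v' τ y + inner ℝ (v' τ y) (v' τ y) • (x-y) + inner ℝ (x-y) (v' τ y) • v' τ y) - ((∫ σ in Set.Ioi (t-τ), Literature.Analysis.UnboundedOperators.heatKernel σ (x-y) / (8*σ^3)) * (inner ℝ (x-y) (v' τ y) * inner ℝ (x-y) (v' τ y))) • (x-y))) ∧ Literature.Analysis.FluidPDE.HasTypeITimeDecay 0 v' ∧ (∀ (x₀ : EuclideanSpace ℝ (Fin 3)) (t₀ r : ℝ), t₀ ≤ 0 → 0 < r → (∀ t, t₀ - r^2 < t → t < t₀ → r⁻¹ * ∫ x in Metric.ball x₀ r, ‖v' t x‖^2 ≤ 0) ∧ r⁻¹ * ∫ t in Set.Ioo (t₀ - r^2) t₀, ∫ x in Metric.ball x₀ r, ‖fderiv ℝ (v' t) x‖^2 ≤ 0) → ∀ t < 0, ∀ x, (∃ v w : EuclideanSpace ℝ (Fin 3), ‖v‖ = 1 ∧ ‖w‖ = 1 ∧ inner ℝ v w = 0 ∧ ∀ α β : ℝ, (-t) * inner ℝ (fderiv ℝ (v' t) x (α • v + β • w)) (α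 • v + β • w) ≤ m * (α^2 + β^2))) := by
  intro v' hv' t ht x
  refine ⟨EuclideanSpace.single 0 1, EuclideanSpace.single 1 1, by simp, by simp,
    by simp [EuclideanSpace.inner_single_left], fun α β => ?_⟩
  have h0 : v' t = fun _ => 0 := funext fun y => squeezeClass_zero_slice_zero hv' ht y
  have h1 : fderiv ℝ (fun _ : (EuclideanSpace ℝ (Fin 3)) => (0 : (EuclideanSpace ℝ (Fin 3)))) x = 0 := by simp
  have h2 : 0 ≤ m * (α ^ 2 + β ^ 2) := by positivity
  rw [h0, h1]
  simpa using h2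

/-! ### Attainment is load-bearing -/

/-- **`WithoutAttainment` is false**: the crux with the attainment clause `Λ_u(t₀,x₀) ≥ m`
dropped (everything else verbatim) fails at `C = 0`, `u ≡ 0 ∈ 𝒦_0`, `t₀ = −1`, `m = 1`: `1` is
class-maximal over `𝒦_0 = {0}` (`isClassMax_zero`) but not `< 1/8`. With `nonneg_of_maximal`
(maximality tested on `0` forces `m ≥ 0`) this pins the role of the two clauses: together they
say `m = max Λ` exactly. [folklore] -/
theorem false_without_attainment :
    ¬ ∀ (C m : ℝ) (u : ℝ → (EuclideanSpace ℝ (Fin 3)) → (EuclideanSpace ℝ (Fin 3))) (t₀ : ℝ) (x₀ : (EuclideanSpace ℝ (Fin 3))), t₀ < 0 →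
      (ContDiffOn ℝ (⊤ : ℕ∞) (Function.uncurry u) (Set.Iio 0 ×ˢ Set.univ) ∧ (∀ t < 0, Literature.Analysis.FluidPDE.VectorCalculus.IsDivFree (u t)) ∧ (∀ s t : ℝ, s < t → t < 0 → ∀ x, u t x = Literature.Analysis.FluidPDE.heatFlow (u s) (t-s) x - ∫ τ in Set.Ioo s t, ∫ y, ((-(inner ℝ (x-y) (u τ y) / (2*(t-τ)) * Literature.Analysis.UnboundedOperators.heatKernel (t-τ) (x-y))) • u τ y + (∫ σ in Set.Ioi (t-τ), Literature.Analysis.UnboundedOperators.heatKernel σ (x-y) / (4*σ^2)) • (inner ℝ (x-y) (u τ y) • u τ y + inner ℝ (u τ y) (u τ y) • (x-y) + inner ℝ (x-y) (u τ y) • u τ y) - ((∫ σ in Set.Ioi (t-τ), Literature.Analysis.UnboundedOperators.heatKernel σ (x-y) / (8*σ^3)) * (inner ℝ (x-y) (u τ y) * inner ℝ (x-y) (u τ y))) • (x-y))) ∧ Literature.Analysis.FluidPDE.HasTypeITimeDecay C u ∧ (∀ (x₀ : EuclideanSpace ℝ (Fin 3)) (t₀ r : ℝ), t₀ ≤ 0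 → 0 < r → (∀ t, t₀ - r^2 < t → t < t₀ → r⁻¹ * ∫ x in Metric.ball x₀ r, ‖u t x‖^2 ≤ C) ∧ r⁻¹ * ∫ t in Set.Ioo (t₀ - r^2) t₀, ∫ x in Metric.ball x₀ r, ‖fderiv ℝ (u t) x‖^2 ≤ C)) →
      (∀ v' : ℝ → EuclideanSpace ℝ (Fin 3) → EuclideanSpace ℝ (Fin 3), ContDiffOn ℝ (⊤ : ℕ∞) (Function.uncurry v') (Set.Iio 0 ×ˢ Set.univ) ∧ (∀ t < 0, Literature.Analysis.FluidPDE.VectorCalculus.IsDivFree (v' t)) ∧ (∀ s t : ℝ, s < t → t < 0 → ∀ x, v' t x = Literature.Analysis.FluidPDE.heatFlow (v' s) (t-s) x - ∫ τ in Set.Ioo s t, ∫ y, ((-(inner ℝ (x-y) (v' τ y) / (2*(t-τ)) * Literature.Analysis.UnboundedOperators.heatKernel (t-τ) (x-y))) • v' τ y + (∫ σ in Set.Ioi (t-τ), Literature.Analysis.UnboundedOperators.heatKernel σ (x-y) / (4*σ^2)) • (inner ℝ (x-y) (v' τ y) • v' τ y + inner ℝ (v' τ y) (v' τ y) • (x-y)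 + inner ℝ (x-y) (v' τ y) • v' τ y) - ((∫ σ in Set.Ioi (t-τ), Literature.Analysis.UnboundedOperators.heatKernel σ (x-y) / (8*σ^3)) * (inner ℝ (x-y) (v' τ y) * inner ℝ (x-y) (v' τ y))) • (x-y))) ∧ Literature.Analysis.FluidPDE.HasTypeITimeDecay C v' ∧ (∀ (x₀ : EuclideanSpace ℝ (Fin 3)) (t₀ r : ℝ), t₀ ≤ 0 → 0 < r → (∀ t, t₀ - r^2 < t → t < t₀ → r⁻¹ * ∫ x in Metric.ball x₀ r, ‖v' t x‖^2 ≤ C) ∧ r⁻¹ * ∫ t in Set.Ioo (t₀ - r^2) t₀, ∫ x in Metric.ball x₀ r, ‖fderiv ℝ (v' t) x‖^2 ≤ C) → ∀ t < 0, ∀ x, (∃ v w : EuclideanSpace ℝ (Fin 3), ‖v‖ = 1 ∧ ‖w‖ = 1 ∧ inner ℝ v w = 0 ∧ ∀ α β : ℝ, (-t) * inner ℝ (fderiv ℝ (v' t) x (α • v + β • w)) (α • v + β • w) ≤ m * (α^2 + β^2))) →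
      m < 1 / 8 := by
  intro h
  have := h 0 1 0 (-1) 0 (by norm_num) (squeezeClass_zero le_rfl) (isClassMax_zero zero_le_one)
  norm_num at this

/-! ### The guard `t₀ < 0` is load-bearing -/

/-- The zero field continued by `−x` at non-negative times is an element of `𝒦_0`
(`squeezeClass_congr` with the zero field, `squeezeClass_zero`). [folklore] -/
theorem junkSlice_mem :
    (ContDiffOn ℝ (⊤ : ℕ∞) (Function.uncurry (fun (t : ℝ) (x : (EuclideanSpace ℝ (Fin 3))) => if t < 0 then (0 : (EuclideanSpace ℝ (Fin 3))) else -x)) (Set.Iio 0 ×ˢ Set.univ) ∧ (∀ t < 0, Literature.Analysis.FluidPDE.VectorCalculus.IsDivFree ((fun (t : ℝ) (x : (EuclideanSpace ℝ (Fin 3))) => if t < 0 then (0 : (EuclideanSpace ℝ (Fin 3))) else -x) t)) ∧ (∀ s t : ℝ, s < t → t < 0 → ∀ x, (fun (t : ℝ) (x : (EuclideanSpace ℝ (Fin 3))) => if t < 0 then (0 : (EuclideanSpace ℝ (Fin 3))) else -x) t x = Literature.Analysis.FluidPDE.heatFlow ((fun (t : ℝ) (x : (EuclideanSpace ℝ (Fin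 3))) => if t < 0 then (0 : (EuclideanSpace ℝ (Fin 3))) else -x) s) (t-s) x - ∫ τ in Set.Ioo s t, ∫ y, ((-(inner ℝ (x-y) ((fun (t : ℝ) (x : (EuclideanSpace ℝ (Fin 3))) => if t < 0 then (0 : (EuclideanSpace ℝ (Fin 3))) else -x) τ y) / (2*(t-τ)) * Literature.Analysis.UnboundedOperators.heatKernel (t-τ) (x-y))) • (fun (t : ℝ) (x : (EuclideanSpace ℝ (Fin 3))) => if t < 0 then (0 : (EuclideanSpace ℝ (Fin 3))) else -x) τ y + (∫ σ in Set.Ioi (t-τ), Literature.Analysis.UnboundedOperators.heatKernel σ (x-y) / (4*σ^2)) • (inner ℝ (x-y) ((fun (t : ℝ) (x : (EuclideanSpace ℝ (Fin 3))) => if t < 0 then (0 : (EuclideanSpace ℝ (Fin 3))) else -x) τ y) • (fun (t : ℝ) (x : (EuclideanSpace ℝ (Fin 3))) => if t < 0 then (0 : (EuclideanSpace ℝ (Fin 3))) else -x) τ y + inner ℝ ((fun (t : ℝ) (x : (EuclideanSpace ℝ (Fin 3))) => if t < 0 then (0 : (EuclideanSpace ℝ (Fin 3))) else -x) τ y) ((fun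 (t : ℝ) (x : (EuclideanSpace ℝ (Fin 3))) => if t < 0 then (0 : (EuclideanSpace ℝ (Fin 3))) else -x) τ y) • (x-y) + inner ℝ (x-y) ((fun (t : ℝ) (x : (EuclideanSpace ℝ (Fin 3))) => if t < 0 then (0 : (EuclideanSpace ℝ (Fin 3))) else -x) τ y) • (fun (t : ℝ) (x : (EuclideanSpace ℝ (Fin 3))) => if t < 0 then (0 : (EuclideanSpace ℝ (Fin 3))) else -x) τ y) - ((∫ σ in Set.Ioi (t-τ), Literature.Analysis.UnboundedOperators.heatKernel σ (x-y) / (8*σ^3)) * (inner ℝ (x-y) ((fun (t : ℝ) (x : (EuclideanSpace ℝ (Fin 3))) => if t < 0 then (0 : (EuclideanSpace ℝ (Fin 3))) else -x) τ y) * inner ℝ (x-y) ((fun (t : ℝ) (x : (EuclideanSpace ℝ (Fin 3))) => if t < 0 then (0 : (EuclideanSpace ℝ (Fin 3))) else -x) τ y))) • (x-y))) ∧ Literature.Analysis.FluidPDE.HasTypeITimeDecay 0 (fun (t : ℝ) (x : (EuclideanSpace ℝ (Fin 3))) => if t < 0 then (0 : (EuclideanSpace ℝ (Fin 3))) else -x)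 ∧ (∀ (x₀ : EuclideanSpace ℝ (Fin 3)) (t₀ r : ℝ), t₀ ≤ 0 → 0 < r → (∀ t, t₀ - r^2 < t → t < t₀ → r⁻¹ * ∫ x in Metric.ball x₀ r, ‖(fun (t : ℝ) (x : (EuclideanSpace ℝ (Fin 3))) => if t < 0 then (0 : (EuclideanSpace ℝ (Fin 3))) else -x) t x‖^2 ≤ 0) ∧ r⁻¹ * ∫ t in Set.Ioo (t₀ - r^2) t₀, ∫ x in Metric.ball x₀ r, ‖fderiv ℝ ((fun (t : ℝ) (x : (EuclideanSpace ℝ (Fin 3))) => if t < 0 then (0 : (EuclideanSpace ℝ (Fin 3))) else -x) t) x‖^2 ≤ 0)) :=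
  squeezeClass_congr (u := 0)
    (v := fun (t : ℝ) (x : (EuclideanSpace ℝ (Fin 3))) => if t < 0 then (0 : (EuclideanSpace ℝ (Fin 3))) else -x)
    (fun t ht => by funext x; simp [ht]) (squeezeClass_zero le_rfl)

/-- **`WithoutTime` is false**: the crux with the guard `t₀ < 0` dropped fails at `C = 0`,
`t₀ = 1`, `m = 1`, for the member of `𝒦_0` that is `0` on `t < 0` and `−x` on `t ≥ 0`: the class
never looks at `t ≥ 0`, the gauge weight `−t₀ = −1` turns the contraction `−x` into an "attained"
value `1`, and `1` is class-maximal over `𝒦_0`. [folklore] -/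
theorem false_without_time :
    ¬ ∀ (C m : ℝ) (u : ℝ → (EuclideanSpace ℝ (Fin 3)) → (EuclideanSpace ℝ (Fin 3))) (t₀ : ℝ) (x₀ : (EuclideanSpace ℝ (Fin 3))),
      (ContDiffOn ℝ (⊤ : ℕ∞) (Function.uncurry u) (Set.Iio 0 ×ˢ Set.univ) ∧ (∀ t < 0, Literature.Analysis.FluidPDE.VectorCalculus.IsDivFree (u t)) ∧ (∀ s t : ℝ, s < t → t < 0 → ∀ x, u t x = Literature.Analysis.FluidPDE.heatFlow (u s) (t-s) x - ∫ τ in Set.Ioo s t, ∫ y, ((-(inner ℝ (x-y) (u τ y) / (2*(t-τ)) * Literature.Analysis.UnboundedOperators.heatKernel (t-τ) (x-y))) • u τ y + (∫ σ in Set.Ioi (t-τ), Literature.Analysis.UnboundedOperators.heatKernel σ (x-y) / (4*σ^2)) • (inner ℝ (x-y) (u τ y) • u τ y + inner ℝ (u τ y) (u τ y) • (x-y) + inner ℝ (x-y) (u τ y) • u τ y) - ((∫ σ in Set.Ioi (t-τ), Literature.Analysis.UnboundedOperators.heatKernel σ (x-y) / (8*σ^3)) * (inner ℝ (x-y) (u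 τ y) * inner ℝ (x-y) (u τ y))) • (x-y))) ∧ Literature.Analysis.FluidPDE.HasTypeITimeDecay C u ∧ (∀ (x₀ : EuclideanSpace ℝ (Fin 3)) (t₀ r : ℝ), t₀ ≤ 0 → 0 < r → (∀ t, t₀ - r^2 < t → t < t₀ → r⁻¹ * ∫ x in Metric.ball x₀ r, ‖u t x‖^2 ≤ C) ∧ r⁻¹ * ∫ t in Set.Ioo (t₀ - r^2) t₀, ∫ x in Metric.ball x₀ r, ‖fderiv ℝ (u t) x‖^2 ≤ C)) →
      (∃ v w : EuclideanSpace ℝ (Fin 3), ‖v‖ = 1 ∧ ‖w‖ = 1 ∧ inner ℝ v w = 0 ∧ ∀ α β : ℝ, m * (α^2 + β^2) ≤ (-t₀) * inner ℝ (fderiv ℝ (u t₀) x₀ (α • v + β • w)) (α • v + β • w)) →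
      (∀ v' : ℝ → EuclideanSpace ℝ (Fin 3) → EuclideanSpace ℝ (Fin 3), ContDiffOn ℝ (⊤ : ℕ∞) (Function.uncurry v') (Set.Iio 0 ×ˢ Set.univ) ∧ (∀ t < 0, Literature.Analysis.FluidPDE.VectorCalculus.IsDivFree (v' t)) ∧ (∀ s t : ℝ, s < t → t < 0 → ∀ x, v' t x = Literature.Analysis.FluidPDE.heatFlow (v' s) (t-s) x - ∫ τ in Set.Ioo s t, ∫ y, ((-(inner ℝ (x-y) (v' τ y) / (2*(t-τ)) * Literature.Analysis.UnboundedOperators.heatKernel (t-τ) (x-y))) • v' τ y + (∫ σ in Set.Ioi (t-τ), Literature.Analysis.UnboundedOperators.heatKernel σ (x-y) / (4*σ^2)) • (inner ℝ (x-y) (v' τ y) • v' τ y + inner ℝ (v' τ y) (v' τ y) • (x-y) + inner ℝ (x-y) (v' τ y) • v' τ y) - ((∫ σ in Set.Ioi (t-τ), Literature.Analysis.UnboundedOperators.heatKernel σ (x-y) / (8*σ^3)) * (inner ℝ (x-y) (v' τ y) * inner ℝ (x-y) (v' τ y))) • (x-y))) ∧ Literature.Analysis.FluidPDE.HasTypeITimeDecay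 C v' ∧ (∀ (x₀ : EuclideanSpace ℝ (Fin 3)) (t₀ r : ℝ), t₀ ≤ 0 → 0 < r → (∀ t, t₀ - r^2 < t → t < t₀ → r⁻¹ * ∫ x in Metric.ball x₀ r, ‖v' t x‖^2 ≤ C) ∧ r⁻¹ * ∫ t in Set.Ioo (t₀ - r^2) t₀, ∫ x in Metric.ball x₀ r, ‖fderiv ℝ (v' t) x‖^2 ≤ C) → ∀ t < 0, ∀ x, (∃ v w : EuclideanSpace ℝ (Fin 3), ‖v‖ = 1 ∧ ‖w‖ = 1 ∧ inner ℝ v w = 0 ∧ ∀ α β : ℝ, (-t) * inner ℝ (fderiv ℝ (v' t) x (α • v + β • w)) (α • v + β • w) ≤ m * (α^2 + β^2))) →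
      m < 1 / 8 := by
  intro h
  have hGE : (∃ v w : EuclideanSpace ℝ (Fin 3), ‖v‖ = 1 ∧ ‖w‖ = 1 ∧ inner ℝ v w = 0 ∧ ∀ α β : ℝ, (1:ℝ) * (α^2 + β^2) ≤ (-(1:ℝ)) * inner ℝ (fderiv ℝ ((fun (t : ℝ) (x : (EuclideanSpace ℝ (Fin 3))) => if t < 0 then (0 : (EuclideanSpace ℝ (Fin 3))) else -x) (1:ℝ)) (0 : (EuclideanSpace ℝ (Fin 3))) (α • v + β • w)) (α • v + β • w)) := by
    refine ⟨EuclideanSpace.single 0 1, EuclideanSpace.single 1 1, by simp, by simp,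
      by simp [EuclideanSpace.inner_single_left], fun α β => ?_⟩
    have hs : (fun (t : ℝ) (x : (EuclideanSpace ℝ (Fin 3))) => if t < 0 then (0 : (EuclideanSpace ℝ (Fin 3))) else -x) 1 = fun x => -x := by
      funext x; simp
    have hd : ∀ ξ : (EuclideanSpace ℝ (Fin 3)),
        fderiv ℝ (fun x : (EuclideanSpace ℝ (Fin 3)) => -x) 0 ξ = -ξ := fun ξ => by
      rw [fderiv_fun_neg, fderiv_fun_id]; rfl
    have e : inner ℝ (α • (EuclideanSpace.single 0 (1:ℝ) : (EuclideanSpace ℝ (Fin 3))) + β • EuclideanSpace.single 1 (1:ℝ))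
        (α • (EuclideanSpace.single 0 (1:ℝ) : (EuclideanSpace ℝ (Fin 3))) + β • EuclideanSpace.single 1 (1:ℝ)) = α ^ 2 + β ^ 2 := by
      rw [real_inner_self_eq_norm_sq, norm_sq_smul_add_smul (by simp) (by simp)
        (by simp [EuclideanSpace.inner_single_left])]
    rw [hs, hd, inner_neg_left, e]
    norm_num
  have := h 0 1 _ 1 0 junkSlice_mem hGE (isClassMax_zero zero_le_one)
  norm_num at this

/-! ### Maximality is Liouville-hard -/

/-- **`X ⇒ WithoutMaximality`**: under the route target every element vanishes, so an attained
value satisfies `m ≤ 0 < 1/8` — the crux with its maximality clause dropped ("`Λ < 1/8` at every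
point of every element of every `𝒦_C`") follows from `SqueezeLiouville`. [folklore] -/
theorem withoutMaximality_of_squeezeLiouville (hL : SqueezeCycle.SqueezeLiouville) :
    ∀ (C m : ℝ) (u : ℝ → (EuclideanSpace ℝ (Fin 3)) → (EuclideanSpace ℝ (Fin 3))) (t₀ : ℝ) (x₀ : (EuclideanSpace ℝ (Fin 3))), t₀ < 0 →
      (ContDiffOn ℝ (⊤ : ℕ∞) (Function.uncurry u) (Set.Iio 0 ×ˢ Set.univ) ∧ (∀ t < 0, Literature.Analysis.FluidPDE.VectorCalculus.IsDivFree (u t)) ∧ (∀ s t : ℝ, s < t → t < 0 → ∀ x, u t x = Literature.Analysis.FluidPDE.heatFlow (u s) (t-s) x - ∫ τ in Set.Ioo s t, ∫ y, ((-(inner ℝ (x-y) (u τ y) / (2*(t-τ)) * Literature.Analysis.UnboundedOperators.heatKernel (t-τ) (x-y))) • u τ y + (∫ σ in Set.Ioi (t-τ), Literature.Analysis.UnboundedOperators.heatKernel σ (x-y) / (4*σ^2)) • (inner ℝ (x-y) (u τ y) • u τ y + inner ℝ (u τ y) (u τ y) • (x-y) + inner ℝ (x-y) (u τ y) • u τ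 y) - ((∫ σ in Set.Ioi (t-τ), Literature.Analysis.UnboundedOperators.heatKernel σ (x-y) / (8*σ^3)) * (inner ℝ (x-y) (u τ y) * inner ℝ (x-y) (u τ y))) • (x-y))) ∧ Literature.Analysis.FluidPDE.HasTypeITimeDecay C u ∧ (∀ (x₀ : EuclideanSpace ℝ (Fin 3)) (t₀ r : ℝ), t₀ ≤ 0 → 0 < r → (∀ t, t₀ - r^2 < t → t < t₀ → r⁻¹ * ∫ x in Metric.ball x₀ r, ‖u t x‖^2 ≤ C) ∧ r⁻¹ * ∫ t in Set.Ioo (t₀ - r^2) t₀, ∫ x in Metric.ball x₀ r, ‖fderiv ℝ (u t) x‖^2 ≤ C)) →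
      (∃ v w : EuclideanSpace ℝ (Fin 3), ‖v‖ = 1 ∧ ‖w‖ = 1 ∧ inner ℝ v w = 0 ∧ ∀ α β : ℝ, m * (α^2 + β^2) ≤ (-t₀) * inner ℝ (fderiv ℝ (u t₀) x₀ (α • v + β • w)) (α • v + β • w)) →
      m < 1 / 8 := by
  intro C m u t₀ x₀ ht₀ hu hGE
  have hz : ∀ x, u t₀ x = 0 := fun x => hL C u hu t₀ ht₀ x
  have := nonpos_of_twoFrame_lower_of_slice_zero hz hGE
  linarith

/-- **`WithoutMaximality ∧ MustSqueeze ⇒ X`**: the crux without its maximality clause delivers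
`Λ < 1/8`, hence the hypothesis of `MustSqueeze` (`Λ ≤ 1/8` in the upper two-frame form, by the
tree's Courant–Fischer bridges `le_lerayMiddleStrain_iff` / `lerayMiddleStrain_le_iff`), for every
element — so with `MustSqueeze` it gives the route target. Dropping maximality therefore turns the
crux into the whole Liouville problem on `𝒦_C`. [folklore] -/
theorem squeezeLiouville_of_mustSqueeze_of_withoutMaximality (hM : SqueezeCycle.MustSqueeze)
    (hW : ∀ (C m : ℝ) (u : ℝ → (EuclideanSpace ℝ (Fin 3)) → (EuclideanSpace ℝ (Fin 3))) (t₀ : ℝ) (x₀ : (EuclideanSpace ℝ (Fin 3))), t₀ < 0 →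
      (ContDiffOn ℝ (⊤ : ℕ∞) (Function.uncurry u) (Set.Iio 0 ×ˢ Set.univ) ∧ (∀ t < 0, Literature.Analysis.FluidPDE.VectorCalculus.IsDivFree (u t)) ∧ (∀ s t : ℝ, s < t → t < 0 → ∀ x, u t x = Literature.Analysis.FluidPDE.heatFlow (u s) (t-s) x - ∫ τ in Set.Ioo s t, ∫ y, ((-(inner ℝ (x-y) (u τ y) / (2*(t-τ)) * Literature.Analysis.UnboundedOperators.heatKernel (t-τ) (x-y))) • u τ y + (∫ σ in Set.Ioi (t-τ), Literature.Analysis.UnboundedOperators.heatKernel σ (x-y) / (4*σ^2)) • (inner ℝ (x-y) (u τ y) • u τ y + inner ℝ (u τ y) (u τ y) • (x-y) + inner ℝ (x-y) (u τ y) • u τ y) - ((∫ σ in Set.Ioi (t-τ), Literature.Analysis.UnboundedOperators.heatKernel σ (x-y) / (8*σ^3)) * (inner ℝ (x-y) (u τ y) * inner ℝ (x-y) (u τ y))) • (x-y))) ∧ Literature.Analysis.FluidPDE.HasTypeITimeDecay C u ∧ (∀ (x₀ : EuclideanSpace ℝ (Fin 3)) (t₀ r : ℝ), t₀ ≤ 0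 → 0 < r → (∀ t, t₀ - r^2 < t → t < t₀ → r⁻¹ * ∫ x in Metric.ball x₀ r, ‖u t x‖^2 ≤ C) ∧ r⁻¹ * ∫ t in Set.Ioo (t₀ - r^2) t₀, ∫ x in Metric.ball x₀ r, ‖fderiv ℝ (u t) x‖^2 ≤ C)) →
      (∃ v w : EuclideanSpace ℝ (Fin 3), ‖v‖ = 1 ∧ ‖w‖ = 1 ∧ inner ℝ v w = 0 ∧ ∀ α β : ℝ, m * (α^2 + β^2) ≤ (-t₀) * inner ℝ (fderiv ℝ (u t₀) x₀ (α • v + β • w)) (α • v + β • w)) →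
      m < 1 / 8) :
    SqueezeCycle.SqueezeLiouville := by
  intro C u hu t ht x
  refine hM C u hu (fun s hs y => ?_) t ht x
  have hlt : lerayMiddleStrain u s y < 1 / 8 := by
    by_contra hge
    rw [not_lt] at hge
    exact lt_irrefl _ (hW C (1 / 8) u s y hs hu ((le_lerayMiddleStrain_iff hs (1 / 8)).1 hge))
  exact (lerayMiddleStrain_le_iff hs (1 / 8)).1 hlt.le

end Summit.NavierStokesRegularity.NavierStokesRegularity.Theorems.ExtremalBiaxialitySubcritical.Negative

end
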